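import Mathlib
import HarnessLib
import Summits.HubbardSuperconductivity.HubbardSuperconductivity.Theses.KLProgramme
import Summits.HubbardSuperconductivity.HubbardSuperconductivity.Theorems.KLProgrammeKLRegimeSplitGlueV16P4Ex

/-!
# Route `KLProgramme` — crux K3 gen 6, the GLUE item `KLRegimeTwoPointLimitGlueV16 := KLRegimeEngineV16 → KLRegimeBetaSplitV16 → KLRegimeCountertermV16 →
# KLRegimeVolumeLimitV16 → KLRegimeTwoPointAssemblyV16 → KLRegimeTwoPointLimit`, CLOSED by the generic induction `KLRegimeSplit.KLRegimeInductionV16P4Ex`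
# (`…SplitGlueV16P4Ex`, p2 g9 p508174).  Proof only; nothing here asserts superconductivity.
-/

noncomputable section

namespace Summit.HubbardSuperconductivity.HubbardSuperconductivity.Theorems.KLRegimeSplit

set_option linter.dupNamespace false -- summit = problem name (single-conjunct summit), D-0017

/-- The gen-6 glue item holds: the five V16 children imply `KLRegimeTwoPointLimit`. -/
theorem klRegimeTwoPointLimitGlueV16_holds :
    Summit.HubbardSuperconductivity.HubbardSuperconductivity.Theses.KLProgramme.KLRegimeTwoPointLimitGlueV16 :=
  fun h₁ h₂ h₃ h₄ h₅ => KLRegimeInductionV16P4Ex h₁ h₂ h₃ h₄ h₅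

end Summit.HubbardSuperconductivity.HubbardSuperconductivity.Theorems.KLRegimeSplit

end
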